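import Summits.AtomisticToContinuum.HydrodynamicLimit.Theses.JParityClosure
import Literature.MathematicalPhysics.KineticTheory.HardSphereCampbellAssembly
import Literature.MathematicalPhysics.KineticTheory.HardSphereEulerProofs
import Literature.MathematicalPhysics.KineticTheory.MetropolisOddStatistic
import Summits.AtomisticToContinuum.HydrodynamicLimit.Theorems.OddContactSymmetry.Negative.VelocityHoleWeight
import HarnessLib

/-!
# The bare Metropolis weight at an inserted contact configuration (A1 of the P4 assembly)

Crux `JParityClosure.OddContactSymmetry` (stmt-AtomisticToContinuum-17722), line `KineticSlabSketch`,
registered stub `stub_metroWeight_contactInsert` (piece A1 of the assembly of P4 `stub_maxwellDefectFlux`).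

For the configuration `w = contactInsert ε i j ω (zipConfig (xs, vs))` (particle `i` re-inserted at contact
with particle `j` in the unit direction `ω`, `0 < ε < 1/2`, `i ≠ j`), the bare Metropolis weight
`metroOddMark σ N 1 1 1 r ϑ 0 w i j = min(1, e^{−F})` of the crux is written in the weighted-Gaussian-KDE form
consumed by the velocity-level bound K1: the four mollified one-particle laws `hm(xᵢ, u)` entering the surprisal
jump `F` are the finite sums `Σ_k p_k φ_{ϑ²}(u − v_k)` with the configuration-dependent weights
`p_k = (N+1)⁻¹ · 3/(π r³) · max(1 − dist(x_k, xᵢ)/r, 0)` (`integral_empiricalMeasure`, `hMoll_eq_sum`), the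
velocities of `w` are the `vs k` (`contactInsert_vel`, `zipConfig_apply`), and the pre-collisional pair is
`reflectVel ω (vs i, vs j)` because the minimal-image separation of the inserted pair is exactly `εω`
(`sepVec_contactInsert`) and the reflection law only sees the line spanned by the impact direction
(`reflectVel_smul`).  Pure rewriting; no analysis.
-/

noncomputable section

open scoped BigOperators Classical InnerProductSpace ENNReal Topology
open Set MeasureTheory Filter
open Literature.Analysis.FluidPDE Literature.MathematicalPhysics.KineticTheory

namespace Summit.AtomisticToContinuum.HydrodynamicLimit.Theorems.OddContactSymmetryKineticSlab

/-- The `(r, ϑ)`-mollified empirical one-particle law of a configuration `w` read at `x₀`, as a weighted Gaussian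
KDE: `hm(x₀, u) = Σ_k p_k φ_{ϑ²}(u − v_k)` with `p_k = (N+1)⁻¹ · 3/(π r³) · max(1 − dist(x_k, x₀)/r, 0)`
(the factor `(N+1)⁻¹` of `hMoll_eq_sum` pushed into the weights). [folklore] -/
theorem hMoll_eq_sum_weights {N : ℕ} (w : Config (N + 1) (Fin 3) T3) (r ϑ : ℝ) (x₀ : T3) (u : V3) :
    ∫ q, 3 / (Real.pi * r ^ 3) * max (1 - Torus.euclidDist q.1 x₀ / r) 0 *
        localMaxwellian 1 (ϑ ^ 2) u q.2 ∂(empiricalMeasure w) =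
      ∑ k, (((N : ℝ) + 1)⁻¹ * (3 / (Real.pi * r ^ 3) * max (1 - Torus.euclidDist (w k).1 x₀ / r) 0)) *
        localMaxwellian 1 (ϑ ^ 2) u (w k).2 := by
  rw [OddContactSymmetryNegative.hMoll_eq_sum, Finset.mul_sum]
  exact Finset.sum_congr rfl fun k _ => by ring

/-- **The bare Metropolis weight of a configuration in KDE form.**  For every configuration `z` and ordered pair
`(i, j)`, `metroOddMark σ N 1 1 1 r ϑ s z i j = min(1, e^{−F})` with
`F = log hm(v⁻) + log hm(w⁻) − log hm(vᵢ) − log hm(vⱼ)`, each `hm(u) = Σ_k p_k φ_{ϑ²}(u − v_k)` read at `xᵢ`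
and `(v⁻, w⁻) = reflectVel (sepVec xᵢ xⱼ) (vᵢ, vⱼ)`. [folklore] -/
theorem metroOddMark_one_eq {σ : ℝ} {N : ℕ} (r ϑ s : ℝ) (z : Config (N + 1) (Fin 3) T3) (i j : Fin (N + 1)) :
    metroOddMark σ N (fun _ => 1) (fun _ => 1) (fun _ => 1) r ϑ s z i j =
      min 1 (Real.exp (-(
        Real.log (∑ k, (((N : ℝ) + 1)⁻¹ * (3 / (Real.pi * r ^ 3) *
            max (1 - Torus.euclidDist (z k).1 (z i).1 / r) 0)) *
            localMaxwellian 1 (ϑ ^ 2)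
              (reflectVel ((Torus.geometry (Fin 3)).sepVec (z i).1 (z j).1) ((z i).2, (z j).2)).1 (z k).2) +
        Real.log (∑ k, (((N : ℝ) + 1)⁻¹ * (3 / (Real.pi * r ^ 3) *
            max (1 - Torus.euclidDist (z k).1 (z i).1 / r) 0)) *
            localMaxwellian 1 (ϑ ^ 2)
              (reflectVel ((Torus.geometry (Fin 3)).sepVec (z i).1 (z j).1) ((z i).2, (z j).2)).2 (z k).2) -
        Real.log (∑ k, (((N : ℝ) + 1)⁻¹ * (3 / (Real.pi * r ^ 3) *
            max (1 - Torus.euclidDist (z k).1 (z i).1 / r) 0)) *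
            localMaxwellian 1 (ϑ ^ 2) (z i).2 (z k).2) -
        Real.log (∑ k, (((N : ℝ) + 1)⁻¹ * (3 / (Real.pi * r ^ 3) *
            max (1 - Torus.euclidDist (z k).1 (z i).1 / r) 0)) *
            localMaxwellian 1 (ϑ ^ 2) (z j).2 (z k).2)))) := by
  dsimp only [metroOddMark]
  simp only [one_mul, hMoll_eq_sum_weights]

/-- **A1: the Metropolis weight at an inserted contact configuration in the K1 (weighted Gaussian KDE) form.**
For `0 < ε < 1/2`, `i ≠ j`, a unit direction `ω`, positions `xs` and velocities `vs`, with
`w = contactInsert ε i j ω (zipConfig (xs, vs))`: `metroOddMark σ N 1 1 1 r ϑ 0 w i j = min(1, e^{−F})` where the four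
mollified laws of `F` are the weighted Gaussian KDEs `Σ_k p_k φ_{ϑ²}(u − vs k)` with
`p_k = (N+1)⁻¹ · 3/(π r³) · max(1 − dist((w k).1, (w i).1)/r, 0)`, queried at
`u ∈ {(reflectVel ω (vs i, vs j)).1, (reflectVel ω (vs i, vs j)).2, vs i, vs j}` (the separation of the inserted pair
is `εω`, `sepVec_contactInsert`, and `reflectVel (εω) = reflectVel ω`, `reflectVel_smul`). [folklore] -/
theorem stub_metroWeight_contactInsert :
    ∀ {σ : ℝ} {N : ℕ} {ε : ℝ} (_hε : 0 < ε) (_hε2 : ε < 1 / 2) (r ϑ : ℝ) {i j : Fin (N + 1)} (_hij : i ≠ j)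
    (ω : Metric.sphere (0 : V3) 1) (xs : Fin (N + 1) → T3) (vs : Fin (N + 1) → V3),
    metroOddMark σ N (fun _ => 1) (fun _ => 1) (fun _ => 1) r ϑ 0 (contactInsert ε i j (ω : V3) (zipConfig (xs, vs))) i j =
      min 1 (Real.exp (-(
        Real.log (∑ k, (((N : ℝ) + 1)⁻¹ * (3 / (Real.pi * r ^ 3) *
            max (1 - Torus.euclidDist ((contactInsert ε i j (ω : V3) (zipConfig (xs, vs))) k).1
              ((contactInsert ε i j (ω : V3) (zipConfig (xs, vs))) i).1 / r) 0)) *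
            localMaxwellian 1 (ϑ ^ 2) (reflectVel (ω : V3) (vs i, vs j)).1 (vs k)) +
        Real.log (∑ k, (((N : ℝ) + 1)⁻¹ * (3 / (Real.pi * r ^ 3) *
            max (1 - Torus.euclidDist ((contactInsert ε i j (ω : V3) (zipConfig (xs, vs))) k).1
              ((contactInsert ε i j (ω : V3) (zipConfig (xs, vs))) i).1 / r) 0)) *
            localMaxwellian 1 (ϑ ^ 2) (reflectVel (ω : V3) (vs i, vs j)).2 (vs k)) -
        Real.log (∑ k, (((N : ℝ) + 1)⁻¹ * (3 / (Real.pi * r ^ 3) *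
            max (1 - Torus.euclidDist ((contactInsert ε i j (ω : V3) (zipConfig (xs, vs))) k).1
              ((contactInsert ε i j (ω : V3) (zipConfig (xs, vs))) i).1 / r) 0)) *
            localMaxwellian 1 (ϑ ^ 2) (vs i) (vs k)) -
        Real.log (∑ k, (((N : ℝ) + 1)⁻¹ * (3 / (Real.pi * r ^ 3) *
            max (1 - Torus.euclidDist ((contactInsert ε i j (ω : V3) (zipConfig (xs, vs))) k).1
              ((contactInsert ε i j (ω : V3) (zipConfig (xs, vs))) i).1 / r) 0)) *
            localMaxwellian 1 (ϑ ^ 2) (vs j) (vs k))))) := by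
  intro σ N ε hε hε2 r ϑ i j hij ω xs vs
  have hω : ‖(ω : V3)‖ = 1 := norm_eq_of_mem_sphere ω
  -- the separation of the inserted pair is `εω`, so the pre-collisional pair is `reflectVel ω (vs i, vs j)`
  have hsep : (Torus.geometry (Fin 3)).sepVec (contactInsert ε i j (ω : V3) (zipConfig (xs, vs)) i).1
      (contactInsert ε i j (ω : V3) (zipConfig (xs, vs)) j).1 = ε • (ω : V3) :=
    sepVec_contactInsert hε.le hε2 hij hω.le _
  rw [metroOddMark_one_eq, hsep, reflectVel_smul hε.ne']
  -- all velocities of the inserted configuration are the `vs k`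
  simp only [contactInsert_vel, zipConfig_apply]

end Summit.AtomisticToContinuum.HydrodynamicLimit.Theorems.OddContactSymmetryKineticSlab

end
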